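import Mathlib
import Summits.ValiantsHypothesis.ValiantsHypothesis.Theses.GeneratorObstructions

/-! Sketch: first lemma of the crux idea `chow-covariant-generation` — the diagonal monomial (a point of the Chow
variety `Ch_m`) lies in BOTH orbit closures, so `A(Δ per_m) ↠ A(Δ monomial) ↞ A(Δ tr X^m)` (GenPrinciple both ways). -/

open MvPolynomial
open Literature.NumberTheory.DiophantineGeometry Literature.Computability.AlgebraicComplexity

namespace Summit.ValiantsHypothesis.ValiantsHypothesis.Cruxes.GenFlipThesis.Sketch

set_option linter.dupNamespace false

/-- First lemma (idea `chow-covariant-generation`): the diagonal monomial `x₁₁ x₂₂ ⋯ x_mm` is a common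
degeneration of the block permanent and of the power trace (End-orbits: kill the off-diagonal block
variables in `per_m`; substitute the `m`-cycle matrix in `tr X^m`). -/
def FirstLemmaChowInBoth : Prop :=
  ∀ m e : ℕ, 1 ≤ m →
    (∏ i : Fin m, (X (toLex (Fin.castAdd e i, Fin.castAdd e i)) : MvPolynomial (MatIdx (m + e)) ℂ)) ∈
        orbitClosure (MvPolynomial.rename (fun ij : Fin m × Fin m => toLex (Fin.castAdd e ij.1, Fin.castAdd e ij.2))
          (perPoly (Fin m) ℂ)) ∧
    (∏ i : Fin m, (X (toLex (Fin.castAdd e i, Fin.castAdd e i)) : MvPolynomial (MatIdx (m + e)) ℂ)) ∈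
        orbitClosure (powFormLex ℂ (m + e) m)

/-- The decisive consequence (GenPrinciple, proved): every generator-degree statement transfers DOWN to the
monomial's closure = the Chow variety `Ch_m(ℂ^{(m+e)²})`; so `gen.deg A(Ch_m)` super-qp ⇒ K1 ∧ ¬K2, qp ⇒ consistent. -/
def ChowGenQP : Prop :=
  ∀ c : ℕ, ∃ c₀ : ℕ, ∀ m e : ℕ, 1 ≤ m → m + e ≤ 2 ^ ((Nat.log 2 m + c) ^ c) →
    ∀ χ : Weight (MatIdx (m + e)),
      Module.finrank ℂ (↥(highestWeightSpace (orbitCoordRep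
          (∏ i : Fin m, (X (toLex (Fin.castAdd e i, Fin.castAdd e i)) : MvPolynomial (MatIdx (m + e)) ℂ)) m) χ) ⧸
        Submodule.comap (highestWeightSpace (orbitCoordRep
          (∏ i : Fin m, (X (toLex (Fin.castAdd e i, Fin.castAdd e i)) : MvPolynomial (MatIdx (m + e)) ℂ)) m) χ).subtype
          (⨆ p : Weight (MatIdx (m + e)) × Weight (MatIdx (m + e)), ⨆ (_ : p.1 + p.2 = χ ∧ p.1 ≠ 0 ∧ p.2 ≠ 0),
            highestWeightSpace (orbitCoordRep
              (∏ i : Fin m, (X (toLex (Fin.castAdd e i, Fin.castAdd e i)) : MvPolynomial (MatIdx (m + e)) ℂ)) m) p.1 *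
            highestWeightSpace (orbitCoordRep
              (∏ i : Fin m, (X (toLex (Fin.castAdd e i, Fin.castAdd e i)) : MvPolynomial (MatIdx (m + e)) ℂ)) m) p.2)) ≠ 0 →
      -(Weight.size χ) ≤ (m : ℤ) * 2 ^ ((Nat.log 2 m + c₀) ^ c₀)

/-- `PowGenDegreeQP → ChowGenQP` is GenPrinciple + the first lemma (necessary condition for K2). -/
example : Prop := Summit.ValiantsHypothesis.ValiantsHypothesis.Theses.GeneratorObstructions.PowGenDegreeQP → ChowGenQP

end Summit.ValiantsHypothesis.ValiantsHypothesis.Cruxes.GenFlipThesis.Sketch
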